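import Literature.MathematicalPhysics.QuantumFieldTheory.Balaban1983to89.B6HolderPairInputsV1
import Literature.MathematicalPhysics.QuantumFieldTheory.Balaban1983to89.B6CubePairOutDecayV1
import Literature.MathematicalPhysics.QuantumFieldTheory.Balaban1983to89.B6CubeRightLegsV1

/-!
# `Balaban1983to89.B6HolderGrad2GEPairInputsV1` — T. Bałaban, *Propagators and renormalization transformations for lattice gauge theories. II*,
Comm. Math. Phys. **96** (1984) 223–250 [Balaban1984PropagatorsII], Prop. 2.6 (2.139) p. 247 with (2.133)/(2.141) p. 247: **THE INPUT-LOCALISED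
PAIR MAJORANT OF THE RIGHT LEGS `P_{x,x′}·G_□·E_e` FOR AN ADMISSIBLE GLOBAL PAIR** — the `G_□∇_λ*`/`G_□∇_λ` twin of p22's
`…B6HolderPairInputsV1.pairInputs_cube` (which serves `E_(ν,+)G_□` and `G_□`), needed by the `(∇_μh_□)·G_□E_(ν,−)·(S_νh_□)` term of the n = 0 leg
of (2.139) (`…B6Grad2LegLettersKLevelV1.grad2_sandwich_eq`).

HONEST FRAMING (programme rule): statement-level skeleton of published theorems with citation tags; proofs where landed; nothing here
is a claim about the Yang–Mills mass gap.

## WHAT THIS FILE CERTIFIES (kernel-checked, sorry-free, standard axioms; THEOREMS ONLY)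

* §1 **`hHGEin_cube`** — chart frame: for window bonds `c₁, c₂` of the same direction with charted initial points at sup-distance `≤ L^{j_t}`,
  `InMajorant (geomT D) (blkV1 hN D) (P_{c₁+v,c₂+v}·(G_□·E_e)) (Q^T_□) (C_H·t_m^α·pref·e^{−δ_H d_T})` — p38's member pair majorant
  `…B6CubePairOutDecayV1.holderGE_member` ([4] (1.111)₂ and its input-shift twin) through r03's band bridge `inDecay_window_V1`, exactly as p22's
  `…B6CubeHolderInDecayV1.hHEGin_cube`;
* §2 **`pairInputsGE_cube`** — admissible global pairs `(x, x′)` (same direction, `|x − x′|_∞ ≤ L^{j(y(x))}`, `≤ L^{j(y(x′))}`, `h_□ ≠ 0` at `x`, `x + e_ν`,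
  `x′` or `x′ + e_ν`, level comparability and `d_T(y(x), y(x′)) ≤ r₀` displayed):
  `InMajorant (P_{x,x′}·(G_□·E_e)) (Q^T_□) (C_P·e^{ρ₁r₀}·L²t^α·pref·e^{−ρ′d_T})`, `t = |x − x′|_∞/L^{j(y(x))}` — close pairs by §1 and p22's window
  geometry, the remaining ones by two single-point letters `…B6CubeRightLegsV1.hGEin_cube` (p22), as in `pairInputs_cube`.

HONEST SCOPE: one cube, one leg `e`, one admissible pair; constants ours on `d, L, a₀, a₁, α`; V1 torus (`L ≥ 5`, `M_h = Lᵃ ≥ 8`, `R ≥ 2L²`,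
`P′ ≥ 5`).  NOT summit progress.  Unit `pub-ymgap-dag-n02-b` (Track-A seat, D-0062; slot c4 of node N03), 2026-08-26.
-/

noncomputable section

open scoped BigOperators
open Finset

namespace Literature.MathematicalPhysics.QuantumFieldTheory.Balaban1983to89.B6HolderGrad2GEPairInputsV1

open LatticeFieldCalculus
open B6MultiLevelBoxOperator (N0 bigSide)
open B6MultiLevelTorusOperator (TDomains)
open B6Eq238MultiLevelTorus (svec)
open B6Cover236MultiLevelBlocks (cubes)
open B6Geom246MultiLevelBox (bset)
open B6Geom246MultiLevelTorus (geomT blkMap)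
open B6Partition118KLevelTorusCentral (one_le_of_four_le)
open B6GlobalChartV1 (PV toBox blkV1 domT)
open B6AgreeLapV1Chart (cB eB mem_cB_W)
open B6Prop26KLevelSkeletonV1 (hB ST mem_ST pref pref_nonneg blkV1_mem_QT_of_hB_ne_zero)
open B6SectAOperatorsV1 (BondIdx)
open B6InMajorantTransplant (InMajorant inMajorant_mono inMajorant_congr_set inMajorant_conj_chart)
open B6InDecayWindowV1 (inMajorant_smul_of_le_on inDecay_window_V1)
open B6TranslateTorusV1 (vch TB kernel_blkMap)
open B6Eq292MemberTorusV1 (EC)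
open B6CubeWindowV1 (x0 j0 tC tC_j sc hx0 hfit Placed wC Gl SQ mem_SQ mem_blkMap_image_SQ)
open B6CubeInDecayV1 (hdiv_cube hlev_full hband_cube sc_inv_le_pref transplant_off sc_nonneg smul_kernel_le)
open B6CubeRightLegsV1 (hGEin_cube)
open B6CubePairOutDecayV1 (holderGE_member pairOp_translate_mul_Gl_mul_EC_eq)
open B6GradLegKLevelV1 (blkV1_mem_ST_of_hB_shift_ne_zero)
open B6HolderPairMemberV1 (pairOp pairOp_mul_apply)
open B6HolderPairWindowV1 (pair_window mem_W_of_deep_one)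
open B6HolderPairInputsV1 (inMajorant_pairOp_of_points geomT_dist_triangle level_le_j0_succ_of_mem_ST)

variable {d ℓ : ℕ} {hd : 1 ≤ d + 1} {hL : Odd (ℓ + 1) ∧ 1 < ℓ + 1} {m K : ℕ} {Mh k R : ℕ} {P' : Fin (d + 1) → ℕ}

/-! ## §1  The chart frame: the pair majorant of `G_□·E_e`, input-localised over `□⁺`, global decay -/

section Chart

/-- **`hHGEin` FOR THE CUBE (INPUT-LOCALISED, GLOBAL DECAY)** — the `G_□·E_e` twin of p22's `hHEGin_cube`: there is `δ_H > 0` and for every `0 ≤ α < 1`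
a constant `C_H ≥ 0` (on `d, L, a₀, a₁, α`) such that on every V1 global torus (`L ≥ 5`, `M_h ≥ 2`, `R ≥ 2L²`), for every placed cube `□`, weights, fine
factor, leg `e` and window bonds `c₁, c₂` of the same direction with charted initial points at sup-distance `≤ L^{j_t}` on `T_□`:
`InMajorant (geomT D) (blkV1 hN D) (P_{c₁+v,c₂+v}·(G_□·E_e)) (□⁺) (C_H·t^α·(L^{j(y)}/c′)²·e^{−δ_H d_T(y,y′)})`, `t = |ec₁ − ec₂|_∞/L^{j_t}`.
[cite: Balaban1984PropagatorsII, (2.133) p.247, Prop. 2.5 p.246, (2.139)/(2.141) p.247, (2.92) p.239 (line 1); Balaban1984PropagatorsI, (1.111) p.35] -/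
theorem hHGEin_cube (d ℓ : ℕ) (hd : 1 ≤ d + 1) (hL : Odd (ℓ + 1) ∧ 1 < ℓ + 1) {a₀ a₁ : ℝ} (ha₀ : 0 < a₀) (ha₁ : a₀ ≤ a₁) :
    ∃ δH : ℝ, 0 < δH ∧ ∀ α : ℝ, 0 ≤ α → α < 1 → ∃ CH : ℝ, 0 ≤ CH ∧ ∀ (m K : ℕ) {Mh k R : ℕ} {P' : Fin (d + 1) → ℕ}
      (hN : ∀ μ, N0 ℓ Mh k P' μ = (PV d ℓ m K hd hL).sitesPerDir 0) (D : TDomains d ℓ Mh k P' R) (hk : k ≤ m + K)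
      (hMh1 : 1 ≤ Mh) (hP4 : ∀ μ, 4 ≤ P' μ) {a : ℕ} (hMha : Mh = (ℓ + 1) ^ a) (_ : 2 ≤ Mh) (_ : 2 * (ℓ + 1) ^ 2 ≤ R) (_ : 4 ≤ ℓ)
      (c : ↥(cubes D.toDomains)) (hpl : Placed ℓ k P' c.1) (w : BondIdx (domT hN D hk) → ℝ) (cf : ℝ) (e : Fin (d + 1) × Bool)
      (c₁ c₂ : PBond (PV d ℓ m K hd hL) 0)
      (_ : c₁ ∈ (cB (tC hN hk hMh1 hP4 c ha₁ a (wC hN hk c w) cf) (x0 ℓ Mh k c.1) (hx0 hpl) (hfit hN hMh1 hP4 hMha c ha₁ hpl)).W)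
      (_ : c₂ ∈ (cB (tC hN hk hMh1 hP4 c ha₁ a (wC hN hk c w) cf) (x0 ℓ Mh k c.1) (hx0 hpl) (hfit hN hMh1 hP4 hMha c ha₁ hpl)).W)
      (_ : c₁.dir = c₂.dir)
      (_ : supDist (eB (tC hN hk hMh1 hP4 c ha₁ a (wC hN hk c w) cf) (x0 ℓ Mh k c.1) c₁).src
        (eB (tC hN hk hMh1 hP4 c ha₁ a (wC hN hk c w) cf) (x0 ℓ Mh k c.1) c₂).src ≤ (ℓ + 1) ^ (tC hN hk hMh1 hP4 c ha₁ a (wC hN hk c w) cf).j),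
      InMajorant (g := geomT D) (blkV1 hN D)
        (pairOp (c₁.translate (vch Mh k (svec ℓ k c.1.1 c.1.2))) (c₂.translate (vch Mh k (svec ℓ k c.1.1 c.1.2))) *
          (Gl hN hk hMh1 hP4 hMha c ha₁ hpl w cf * EC hN hk hMh1 hP4 hMha c ha₁ hpl w cf e)) (ST D hMh1 hP4 c)
        (fun y y' => CH * (((supDist (eB (tC hN hk hMh1 hP4 c ha₁ a (wC hN hk c w) cf) (x0 ℓ Mh k c.1) c₁).src (eB (tC hN hk hMh1 hP4 c ha₁ a (wC hN hk c w) cf) (x0 ℓ Mh k c.1) c₂).src : ℕ) : ℝ) / (((ℓ + 1 : ℕ) : ℝ)) ^ (tC hN hk hMh1 hP4 c ha₁ a (wC hN hk c w) cf).j) ^ α *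
          pref cf y * Real.exp (-(δH * (geomT D).dist y y'))) := by
  obtain ⟨δ, hδ, hmemα⟩ := holderGE_member d (ℓ + 1) hd hL ha₀ ha₁
  refine ⟨δ / (((d : ℝ) + 1) * ((9 : ℕ) : ℝ)), by positivity, fun α hα0 hα1 => ?_⟩
  obtain ⟨C, hC, hmem⟩ := hmemα α hα0 hα1
  refine ⟨(((ℓ + 1) ^ (d + 1) : ℕ) : ℝ) * (C * Real.exp (δ * (((d : ℝ) + 1) + ((d : ℝ) + 1)) / (((d : ℝ) + 1) * ((9 : ℕ) : ℝ)))), by positivity, ?_⟩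
  intro m K Mh k R P' hN D hk hMh1 hP4 a hMha hMh hR2 hℓ c hpl w cf e c₁ c₂ hc₁ hc₂ hdir hle
  have hP : ∀ μ, 1 ≤ P' μ := one_le_of_four_le hP4
  have hτ : 0 ≤ (((supDist (eB (tC hN hk hMh1 hP4 c ha₁ a (wC hN hk c w) cf) (x0 ℓ Mh k c.1) c₁).src (eB (tC hN hk hMh1 hP4 c ha₁ a (wC hN hk c w) cf) (x0 ℓ Mh k c.1) c₂).src : ℕ) : ℝ) / (((ℓ + 1 : ℕ) : ℝ)) ^ (tC hN hk hMh1 hP4 c ha₁ a (wC hN hk c w) cf).j) ^ α :=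
    Real.rpow_nonneg (by positivity) _
  have hT' := hmem (tC hN hk hMh1 hP4 c ha₁ a (wC hN hk c w) cf) 0 0 e (eB (tC hN hk hMh1 hP4 c ha₁ a (wC hN hk c w) cf) (x0 ℓ Mh k c.1) c₁)
    (eB (tC hN hk hMh1 hP4 c ha₁ a (wC hN hk c w) cf) (x0 ℓ Mh k c.1) c₂) hdir hle
  have h1 := inDecay_window_V1 (t := tC hN hk hMh1 hP4 c ha₁ a (wC hN hk c w) cf) (x₀ := x0 ℓ Mh k c.1) (hx₀ := hx0 hpl)
    (hfit := hfit hN hMh1 hP4 hMha c ha₁ hpl) hN (D.chart (svec ℓ k c.1.1 c.1.2)) (mul_nonneg hC hτ) hδ.le hT' hMh1 hP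
    (hdiv_cube hN hk hMh1 hP4 c ha₁ (wC hN hk c w) cf) (hlev_full hN hk hMh1 hP4 hMha c ha₁ hR2 (wC hN hk c w) cf) (C := 9) (by norm_num)
    (SQ hMh1 hP4 c) (fun b _ hbS => hband_cube hN hk hMh1 hP4 hMha c ha₁ hℓ hMh hR2 (wC hN hk c w) cf b hbS)
  have h2 := inMajorant_smul_of_le_on (blkV1 hN (D.chart (svec ℓ k c.1.1 c.1.2))) h1 _
    (transplant_off hN hk hMh1 hP4 hMha c ha₁ hpl (wC hN hk c w) cf _) (inv_nonneg.2 (sc_nonneg hMh1 hP4 c cf))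
    (K' := fun y y' => (((ℓ + 1) ^ (d + 1) : ℕ) : ℝ) * (C * (((supDist (eB (tC hN hk hMh1 hP4 c ha₁ a (wC hN hk c w) cf) (x0 ℓ Mh k c.1) c₁).src (eB (tC hN hk hMh1 hP4 c ha₁ a (wC hN hk c w) cf) (x0 ℓ Mh k c.1) c₂).src : ℕ) : ℝ) / (((ℓ + 1 : ℕ) : ℝ)) ^ (tC hN hk hMh1 hP4 c ha₁ a (wC hN hk c w) cf).j) ^ α * Real.exp (δ * (((d : ℝ) + 1) + ((d : ℝ) + 1)) / (((d : ℝ) + 1) * ((9 : ℕ) : ℝ)))) *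
      pref cf y * Real.exp (-(δ / (((d : ℝ) + 1) * ((9 : ℕ) : ℝ)) * (geomT (D.chart (svec ℓ k c.1.1 c.1.2))).dist y y')))
    (fun a b => by have := pref_nonneg cf a; positivity)
    (fun b hb y _ => smul_kernel_le (sc_inv_le_pref hN hk hMh1 hP4 hMha c ha₁ hR2 hpl (wC hN hk c w) cf hb) (by positivity) (by positivity)
      (Real.exp_nonneg _))
  have h3 := inMajorant_conj_chart hN D hMh1 hP (svec ℓ k c.1.1 c.1.2) h2
    (K' := fun y y' => (((ℓ + 1) ^ (d + 1) : ℕ) : ℝ) * (C * (((supDist (eB (tC hN hk hMh1 hP4 c ha₁ a (wC hN hk c w) cf) (x0 ℓ Mh k c.1) c₁).src (eB (tC hN hk hMh1 hP4 c ha₁ a (wC hN hk c w) cf) (x0 ℓ Mh k c.1) c₂).src : ℕ) : ℝ) / (((ℓ + 1 : ℕ) : ℝ)) ^ (tC hN hk hMh1 hP4 c ha₁ a (wC hN hk c w) cf).j) ^ α * Real.exp (δ * (((d : ℝ) + 1) + ((d : ℝ) + 1)) / (((d : ℝ) + 1) * ((9 : ℕ) : ℝ)))) *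
      pref cf y * Real.exp (-(δ / (((d : ℝ) + 1) * ((9 : ℕ) : ℝ)) * (geomT D).dist y y')))
    (fun a b => le_of_eq (kernel_blkMap D hMh1 hP (svec ℓ k c.1.1 c.1.2) (fun n => ((((ℓ + 1 : ℕ) : ℝ)) ^ n / cf) ^ 2) _ _ a b))
  rw [pairOp_translate_mul_Gl_mul_EC_eq hN hk hMh1 hP4 hMha c ha₁ hpl w cf e hc₁ hc₂]
  refine inMajorant_mono _ (inMajorant_congr_set _ (mem_blkMap_image_SQ hMh1 hP4 c) h3) fun y y' _ => le_of_eq ?_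
  ring

end Chart

/-! ## §2  Admissible global pairs -/

section Cube

/-- `(Λ²t)^α ≤ Λ²·t^α` for `Λ² ≥ 1`, `α ≤ 1`, `t ≥ 0`. [folklore] -/
private theorem rpow_scale_le {A t α : ℝ} (hA : 1 ≤ A) (ht : 0 ≤ t) (hα1 : α ≤ 1) : (A * t) ^ α ≤ A * t ^ α := by
  rw [Real.mul_rpow (by linarith) ht]
  refine mul_le_mul_of_nonneg_right ?_ (Real.rpow_nonneg ht _)
  calc A ^ α ≤ A ^ (1 : ℝ) := Real.rpow_le_rpow_of_exponent_le hA hα1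
    _ = A := Real.rpow_one A

/-- `1 ≤ A·t^α` once `A⁻¹ ≤ t ≤ 1`, `A ≥ 1`, `α ≤ 1`. [folklore] -/
private theorem one_le_mul_rpow {A t α : ℝ} (hA : 1 ≤ A) (ht : A⁻¹ ≤ t) (ht1 : t ≤ 1) (hα1 : α ≤ 1) : 1 ≤ A * t ^ α := by
  have hA0 : 0 < A := by linarith
  have ht0 : 0 < t := lt_of_lt_of_le (inv_pos.2 hA0) ht
  have h1 : A⁻¹ ≤ t ^ α := ht.trans ((Real.rpow_one t).symm.le.trans (Real.rpow_le_rpow_of_exponent_ge ht0 ht1 hα1))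
  calc (1 : ℝ) = A * A⁻¹ := (mul_inv_cancel₀ hA0.ne').symm
    _ ≤ A * t ^ α := mul_le_mul_of_nonneg_left h1 hA0.le

/-- `x − 0 = x` for bonds. [folklore] -/
private theorem translate_neg_add (v : Site (PV d ℓ m K hd hL) 0) (x : PBond (PV d ℓ m K hd hL) 0) : (x.translate (-v)).translate v = x := by
  rw [PBond.translate_translate, neg_add_cancel]; cases x; simp [PBond.translate]

open Classical in
/-- **THE PAIR INPUT `P_{x,x′}·G_□·E_e` OF A CUBE FOR AN ADMISSIBLE GLOBAL PAIR** (`L ≥ 5`): there are `ρ′ > 0`, `ρ₁ ≥ 0` and, for every `0 ≤ α < 1`,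
`C_P ≥ 0` (on `d, L`, `α` and the weight band) such that on every admissible V1 torus (`M_h = Lᵃ ≥ 8`, `R ≥ 2L²`, `P′ ≥ 5`, cube placed), for every `c′`,
weights, direction `ν`, leg `e`, cube `□`, `r₀ ≥ 0` and fine bonds `x, x′` with: the same direction, `|x − x′|_∞ ≤ L^{j(y(x))}`, `|x − x′|_∞ ≤ L^{j(y(x′))}`,
`h_□ ≠ 0` at `x`, `x + e_ν`, `x′` or `x′ + e_ν`, `j(y(x′)) ≤ j(y(x)) + 1`, `j(y(x)) ≤ j(y(x′)) + 1`, `d_T(y(x), y(x′)) ≤ r₀`: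
`InMajorant (P_{x,x′}·(G_□·E_e)) □⁺ (C_P·e^{ρ₁r₀}·L²t^α·pref·e^{−ρ′d_T})`, `t = |x − x′|_∞/L^{j(y(x))}`.
[cite: Balaban1984PropagatorsII, Prop. 2.6 (2.139) p.247, (2.133)/(2.141) p.247, p.238 (T_□); Balaban1984PropagatorsI, (1.109)–(1.111) p.35] -/
theorem pairInputsGE_cube (d ℓ : ℕ) (hd : 1 ≤ d + 1) (hL : Odd (ℓ + 1) ∧ 1 < ℓ + 1) {a₀ a₁ : ℝ} (ha₀ : 0 < a₀) (ha₁ : a₀ ≤ a₁) :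
    ∃ ρ' : ℝ, 0 < ρ' ∧ ∃ ρ₁ : ℝ, 0 ≤ ρ₁ ∧ ∀ α : ℝ, 0 ≤ α → α < 1 → ∃ CP : ℝ, 0 ≤ CP ∧ ∀ (m K : ℕ) {Mh k R : ℕ} {P' : Fin (d + 1) → ℕ}
      (hN : ∀ μ, N0 ℓ Mh k P' μ = (PV d ℓ m K hd hL).sitesPerDir 0) (D : TDomains d ℓ Mh k P' R) (hk : k ≤ m + K)
      (hMh1 : 1 ≤ Mh) (hP4 : ∀ μ, 4 ≤ P' μ) {a : ℕ} (hMha : Mh = (ℓ + 1) ^ a) (_ : 8 ≤ Mh) (_ : 2 * (ℓ + 1) ^ 2 ≤ R) (_ : ∀ μ, 5 ≤ P' μ)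
      (_ : 4 ≤ ℓ) (c : ↥(cubes D.toDomains)) (hpl : Placed ℓ k P' c.1) (w : BondIdx (domT hN D hk) → ℝ) (cf : ℝ) (ν : Fin (d + 1))
      (e : Fin (d + 1) × Bool) (r₀ : ℝ) (_ : 0 ≤ r₀) (x x' : PBond (PV d ℓ m K hd hL) 0) (_ : x.dir = x'.dir)
      (_ : supDist x.src x'.src ≤ (ℓ + 1) ^ (blkV1 hN D x).1.1) (_ : supDist x.src x'.src ≤ (ℓ + 1) ^ (blkV1 hN D x').1.1)
      (_ : hB hN D c x ≠ 0 ∨ hB hN D c ⟨x.src.shift ν, x.dir⟩ ≠ 0 ∨ hB hN D c x' ≠ 0 ∨ hB hN D c ⟨x'.src.shift ν, x'.dir⟩ ≠ 0)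
      (_ : (blkV1 hN D x').1.1 ≤ (blkV1 hN D x).1.1 + 1) (_ : (blkV1 hN D x).1.1 ≤ (blkV1 hN D x').1.1 + 1)
      (_ : (geomT D).dist (blkV1 hN D x) (blkV1 hN D x') ≤ r₀),
      InMajorant (g := geomT D) (blkV1 hN D)
        (pairOp x x' * (Gl hN hk hMh1 hP4 hMha c ha₁ hpl w cf * EC hN hk hMh1 hP4 hMha c ha₁ hpl w cf e)) (ST D hMh1 hP4 c)
        (fun y y' => (CP * Real.exp (ρ₁ * r₀) * ((((ℓ + 1 : ℕ) : ℝ)) ^ 2 *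
            ((((supDist x.src x'.src : ℕ) : ℝ) / (((ℓ + 1 : ℕ) : ℝ)) ^ (blkV1 hN D x).1.1) ^ α))) *
          pref cf y * Real.exp (-(ρ' * (geomT D).dist y y'))) := by
  obtain ⟨δA, hδA, hAα⟩ := hHGEin_cube d ℓ hd hL ha₀ ha₁
  obtain ⟨ρE, hρE, CE, hCE, hEin⟩ := hGEin_cube d ℓ hd hL ha₀ ha₁
  refine ⟨min δA ρE, lt_min hδA hρE, ρE, hρE.le, fun α hα0 hα1 => ?_⟩
  obtain ⟨CAH, hCAH, hAmem⟩ := hAα α hα0 hα1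
  refine ⟨CAH + (1 + (((ℓ + 1 : ℕ) : ℝ)) ^ 2) * CE, by positivity, ?_⟩
  intro m K Mh k R P' hN D hk hMh1 hP4 a hMha hM8 hR2 hP5 hℓ c hpl w cf ν e r₀ hr₀ x x' hdir hs1 hs2 hact hl1 hl2 hdT
  have hMh : 2 ≤ Mh := le_trans (by norm_num) hM8
  have hR : 2 * (ℓ + 1) ≤ R := le_trans (by nlinarith : 2 * (ℓ + 1) ≤ 2 * (ℓ + 1) ^ 2) hR2
  have hP : ∀ μ, 1 ≤ P' μ := one_le_of_four_le hP4
  have hdnn : ∀ y y' : (geomT D).Site, 0 ≤ (geomT D).dist y y' := fun _ _ => Nat.cast_nonneg _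
  set Λ : ℝ := ((ℓ + 1 : ℕ) : ℝ) with hΛ
  have hΛ1 : (1 : ℝ) ≤ Λ := by rw [hΛ]; exact_mod_cast Nat.succ_pos ℓ
  have hΛ2 : (1 : ℝ) ≤ Λ ^ 2 := by nlinarith
  set s : ℝ := ((supDist x.src x'.src : ℕ) : ℝ) with hs
  have hs0 : 0 ≤ s := Nat.cast_nonneg _
  set jx : ℕ := (blkV1 hN D x).1.1 with hjx
  set t : ℝ := s / Λ ^ jx with ht
  have hJx : (0 : ℝ) < Λ ^ jx := by positivity
  have ht0 : 0 ≤ t := by positivity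
  have ht1 : t ≤ 1 := by
    rw [ht, div_le_one hJx, hs, hΛ]; exact_mod_cast hs1
  set Er : ℝ := Real.exp (ρE * r₀) with hEr_def
  have hEr1 : 1 ≤ Er := Real.one_le_exp (mul_nonneg hρE.le hr₀)
  -- the active block is in `□⁺`, its level is `≤ j₀ + 1`; hence `|x − x′|_∞ ≤ L^{j₀+1}` and `j(y(x)) ≤ j₀ + 2`
  have hST : blkV1 hN D x ∈ ST D hMh1 hP4 c ∨ blkV1 hN D x' ∈ ST D hMh1 hP4 c := by
    rcases hact with h | h | h | h
    · exact Or.inl ((mem_ST D hMh1 hP4 c _).2 (blkV1_mem_QT_of_hB_ne_zero hN D hMh hR hP4 c h))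
    · exact Or.inl (blkV1_mem_ST_of_hB_shift_ne_zero hN hMh1 hP4 c hM8 hR hP5 ν h)
    · exact Or.inr ((mem_ST D hMh1 hP4 c _).2 (blkV1_mem_QT_of_hB_ne_zero hN D hMh hR hP4 c h))
    · exact Or.inr (blkV1_mem_ST_of_hB_shift_ne_zero hN hMh1 hP4 c hM8 hR hP5 ν h)
  have hjx2 : jx ≤ j0 hMh1 hP4 c + 2 := by
    rcases hST with h | h
    · have := level_le_j0_succ_of_mem_ST hMh hR2 hL c h; omega
    · have := level_le_j0_succ_of_mem_ST hMh hR2 hL c h; omega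
  have hsD : supDist x.src x'.src ≤ (ℓ + 1) ^ (j0 hMh1 hP4 c + 1) := by
    rcases hST with h | h
    · exact hs1.trans (Nat.pow_le_pow_right (Nat.succ_pos ℓ) (level_le_j0_succ_of_mem_ST hMh hR2 hL c h))
    · exact hs2.trans (Nat.pow_le_pow_right (Nat.succ_pos ℓ) (level_le_j0_succ_of_mem_ST hMh hR2 hL c h))
  have hexp : ∀ {r : ℝ}, min δA ρE ≤ r → ∀ u : ℝ, 0 ≤ u → Real.exp (-(r * u)) ≤ Real.exp (-(min δA ρE * u)) :=
    fun hr u hu => Real.exp_le_exp.mpr (neg_le_neg (mul_le_mul_of_nonneg_right hr hu))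
  -- the target size `τ = C_P·Er·L²t^α`
  set τ : ℝ := (CAH + (1 + Λ ^ 2) * CE) * Er * (Λ ^ 2 * t ^ α) with hτ
  have hLt : 0 ≤ Λ ^ 2 * t ^ α := mul_nonneg (by positivity) (Real.rpow_nonneg ht0 _)
  have hτnn : 0 ≤ τ := by rw [hτ]; positivity
  have fin : ∀ {T : Module.End ℝ (PBond (PV d ℓ m K hd hL) 0 → ℝ)} {τ₀ r : ℝ}, τ₀ ≤ τ → min δA ρE ≤ r →
      InMajorant (g := geomT D) (blkV1 hN D) T (ST D hMh1 hP4 c) (fun y y' => τ₀ * pref cf y * Real.exp (-(r * (geomT D).dist y y'))) →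
      InMajorant (g := geomT D) (blkV1 hN D) T (ST D hMh1 hP4 c)
        (fun y y' => τ * pref cf y * Real.exp (-(min δA ρE * (geomT D).dist y y'))) := by
    intro T τ₀ r hτ₀ hr hT
    refine inMajorant_mono (g := geomT D) (blkV1 hN D) hT fun y y' _ => ?_
    have hp := pref_nonneg cf y
    have := hexp hr _ (hdnn y y')
    calc τ₀ * pref cf y * Real.exp (-(r * (geomT D).dist y y')) ≤ τ * pref cf y * Real.exp (-(r * (geomT D).dist y y')) := by
          gcongr
      _ ≤ _ := by gcongr
  by_cases hclose : supDist x.src x'.src ≤ (ℓ + 1) ^ j0 hMh1 hP4 c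
  · -- CLOSE PAIRS: the member's Hölder majorant through the window
    obtain ⟨hdx, hdx', hsm⟩ := pair_window hN hk hMh1 hP4 hMha c ha₁ hM8 hR2 hpl w cf ν hact hsD
    obtain ⟨hWx, -⟩ := mem_W_of_deep_one hN hk hMh1 hP4 hMha c ha₁ (hpl := hpl) (w := w) (cf := cf)
      (b := x.translate (-vch Mh k (svec ℓ k c.1.1 c.1.2))) hdx ν
    obtain ⟨hWx', -⟩ := mem_W_of_deep_one hN hk hMh1 hP4 hMha c ha₁ (hpl := hpl) (w := w) (cf := cf)
      (b := x'.translate (-vch Mh k (svec ℓ k c.1.1 c.1.2))) hdx' ν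
    have hdir' : (x.translate (-vch Mh k (svec ℓ k c.1.1 c.1.2))).dir = (x'.translate (-vch Mh k (svec ℓ k c.1.1 c.1.2))).dir := by
      simp [PBond.translate_dir, hdir]
    have hsm' := hsm.trans hclose
    rw [← tC_j hN hk hMh1 hP4 c ha₁ a (wC hN hk c w) cf] at hsm'
    have hA := hAmem m K hN D hk hMh1 hP4 hMha hMh hR2 hℓ c hpl w cf e _ _ hWx hWx' hdir' hsm'
    rw [translate_neg_add, translate_neg_add] at hA
    have hsms : ((supDist (eB (tC hN hk hMh1 hP4 c ha₁ a (wC hN hk c w) cf) (x0 ℓ Mh k c.1) (x.translate (-vch Mh k (svec ℓ k c.1.1 c.1.2)))).src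
        (eB (tC hN hk hMh1 hP4 c ha₁ a (wC hN hk c w) cf) (x0 ℓ Mh k c.1) (x'.translate (-vch Mh k (svec ℓ k c.1.1 c.1.2)))).src : ℕ) : ℝ) ≤ s := by
      rw [hs]; exact_mod_cast hsm
    have hsm0 : (0 : ℝ) ≤ ((supDist (eB (tC hN hk hMh1 hP4 c ha₁ a (wC hN hk c w) cf) (x0 ℓ Mh k c.1) (x.translate (-vch Mh k (svec ℓ k c.1.1 c.1.2)))).src
        (eB (tC hN hk hMh1 hP4 c ha₁ a (wC hN hk c w) cf) (x0 ℓ Mh k c.1) (x'.translate (-vch Mh k (svec ℓ k c.1.1 c.1.2)))).src : ℕ) : ℝ) :=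
      Nat.cast_nonneg _
    generalize ((supDist (eB (tC hN hk hMh1 hP4 c ha₁ a (wC hN hk c w) cf) (x0 ℓ Mh k c.1) (x.translate (-vch Mh k (svec ℓ k c.1.1 c.1.2)))).src
        (eB (tC hN hk hMh1 hP4 c ha₁ a (wC hN hk c w) cf) (x0 ℓ Mh k c.1) (x'.translate (-vch Mh k (svec ℓ k c.1.1 c.1.2)))).src : ℕ) : ℝ) = sm
      at hA hsms hsm0
    have hJ : (((ℓ + 1 : ℕ) : ℝ)) ^ (tC hN hk hMh1 hP4 c ha₁ a (wC hN hk c w) cf).j = Λ ^ j0 hMh1 hP4 c := by rw [tC_j]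
    rw [hJ] at hA
    have hJ0 : (0 : ℝ) < Λ ^ j0 hMh1 hP4 c := by positivity
    have hq : sm / Λ ^ j0 hMh1 hP4 c ≤ Λ ^ 2 * t := by
      have hpow : Λ ^ jx ≤ Λ ^ 2 * Λ ^ j0 hMh1 hP4 c := by rw [← pow_add]; exact pow_le_pow_right₀ hΛ1 (by omega)
      rw [div_le_iff₀ hJ0, ht]
      calc sm ≤ s := hsms
        _ = s / Λ ^ jx * Λ ^ jx := by field_simp
        _ ≤ s / Λ ^ jx * (Λ ^ 2 * Λ ^ j0 hMh1 hP4 c) := mul_le_mul_of_nonneg_left hpow (by positivity)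
        _ = Λ ^ 2 * (s / Λ ^ jx) * Λ ^ j0 hMh1 hP4 c := by ring
    have hsm0' : 0 ≤ sm / Λ ^ j0 hMh1 hP4 c := by positivity
    have hqα : (sm / Λ ^ j0 hMh1 hP4 c) ^ α ≤ Λ ^ 2 * t ^ α :=
      (Real.rpow_le_rpow hsm0' hq hα0).trans (rpow_scale_le hΛ2 ht0 hα1.le)
    have hCP1 : CAH ≤ (CAH + (1 + Λ ^ 2) * CE) * Er := by
      have h00 : 0 ≤ (1 + Λ ^ 2) * CE := by positivity
      calc CAH ≤ CAH + (1 + Λ ^ 2) * CE := by linarith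
        _ ≤ (CAH + (1 + Λ ^ 2) * CE) * Er := le_mul_of_one_le_right (by positivity) hEr1
    have hτA : CAH * (sm / Λ ^ j0 hMh1 hP4 c) ^ α ≤ τ := by
      rw [hτ]; exact mul_le_mul hCP1 hqα (Real.rpow_nonneg hsm0' _) (by positivity)
    exact fin hτA (min_le_left _ _) (by simpa only [mul_assoc] using hA)
  · -- REMAINING PAIRS (`L^{j₀} < |x − x′|_∞ ≤ L^{j₀+1}`): two single-point letters and the triangle inequality; here `L²t^α ≥ 1`
    push Not at hclose
    have hE' := hEin m K hN D hk hMh1 hP4 hMha hMh hR2 hℓ c hpl w cf e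
    have htlow : (Λ ^ 2)⁻¹ ≤ t := by
      have h1 : Λ ^ j0 hMh1 hP4 c ≤ s := by
        rw [hs, hΛ]; exact_mod_cast (Nat.le_of_lt hclose)
      have hpow : Λ ^ jx ≤ Λ ^ 2 * Λ ^ j0 hMh1 hP4 c := by rw [← pow_add]; exact pow_le_pow_right₀ hΛ1 (by omega)
      rw [ht, le_div_iff₀ hJx, inv_mul_le_iff₀ (by positivity : (0:ℝ) < Λ ^ 2)]
      exact hpow.trans (mul_le_mul_of_nonneg_left h1 (by positivity))
    have hone : 1 ≤ Λ ^ 2 * t ^ α := one_le_mul_rpow hΛ2 htlow ht1 hα1.le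
    have hpref : pref cf (blkV1 hN D x') ≤ Λ ^ 2 * pref cf (blkV1 hN D x) := by
      have h1 : Λ ^ (blkV1 hN D x').1.1 ≤ Λ * Λ ^ jx := by
        rw [← pow_succ']; exact pow_le_pow_right₀ hΛ1 (by omega)
      show (Λ ^ (blkV1 hN D x').1.1 / cf) ^ 2 ≤ Λ ^ 2 * (Λ ^ jx / cf) ^ 2
      rw [div_pow, div_pow, mul_div_assoc']
      by_cases hcf : cf = 0
      · simp [hcf]
      · rw [div_le_div_iff_of_pos_right (by positivity), ← mul_pow]
        exact pow_le_pow_left₀ (by positivity) h1 2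
    have hdist : ∀ y' : (geomT D).Site, (geomT D).dist (blkV1 hN D x) y' - r₀ ≤ (geomT D).dist (blkV1 hN D x') y' := by
      intro y'
      have h1 := geomT_dist_triangle hMh1 hP (blkV1 hN D x) (blkV1 hN D x') y'
      linarith only [h1, hdT]
    have hcmpK : ∀ y' : (geomT D).Site,
        CE * pref cf (blkV1 hN D x') * Real.exp (-(ρE * (geomT D).dist (blkV1 hN D x') y')) ≤
          (Λ ^ 2 * Er) * (CE * pref cf (blkV1 hN D x) * Real.exp (-(ρE * (geomT D).dist (blkV1 hN D x) y'))) := by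
      intro y'
      have h1 : Real.exp (-(ρE * (geomT D).dist (blkV1 hN D x') y')) ≤
          Er * Real.exp (-(ρE * (geomT D).dist (blkV1 hN D x) y')) := by
        rw [hEr_def, ← Real.exp_add]
        refine Real.exp_le_exp.mpr ?_
        have := mul_le_mul_of_nonneg_left (hdist y') hρE.le
        rw [mul_sub] at this
        linarith only [this]
      have hpx := pref_nonneg cf (blkV1 hN D x)
      calc CE * pref cf (blkV1 hN D x') * Real.exp (-(ρE * (geomT D).dist (blkV1 hN D x') y'))
          ≤ CE * (Λ ^ 2 * pref cf (blkV1 hN D x)) * (Er * Real.exp (-(ρE * (geomT D).dist (blkV1 hN D x) y'))) :=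
            mul_le_mul (mul_le_mul_of_nonneg_left hpref hCE) h1 (Real.exp_nonneg _) (by positivity)
        _ = (Λ ^ 2 * Er) * (CE * pref cf (blkV1 hN D x) * Real.exp (-(ρE * (geomT D).dist (blkV1 hN D x) y'))) := by ring
    have hM0 : 0 ≤ Λ ^ 2 * Er := by positivity
    have hA0 := inMajorant_pairOp_of_points (g := geomT D) (blkV1 hN D) x x'
      (K := fun y y' => CE * pref cf y * Real.exp (-(ρE * (geomT D).dist y y')))
      (fun a b => by have := pref_nonneg cf a; positivity) hE' hM0 (fun y' _ => hcmpK y')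
    have hA1 : InMajorant (g := geomT D) (blkV1 hN D)
        (pairOp x x' * (Gl hN hk hMh1 hP4 hMha c ha₁ hpl w cf * EC hN hk hMh1 hP4 hMha c ha₁ hpl w cf e)) (ST D hMh1 hP4 c)
        (fun y y' => ((1 + Λ ^ 2 * Er) * CE) * pref cf y * Real.exp (-(ρE * (geomT D).dist y y'))) :=
      inMajorant_mono (g := geomT D) (blkV1 hN D) hA0 fun y y' _ => le_of_eq (by ring)
    have hkey : (1 + Λ ^ 2 * Er) * CE ≤ τ := by
      rw [hτ]
      have h1a : 1 + Λ ^ 2 * Er ≤ (1 + Λ ^ 2) * Er := by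
        calc 1 + Λ ^ 2 * Er ≤ Er + Λ ^ 2 * Er := by linarith only [hEr1]
          _ = (1 + Λ ^ 2) * Er := by ring
      have h1 : (1 + Λ ^ 2 * Er) * CE ≤ ((1 + Λ ^ 2) * CE) * Er := by
        calc (1 + Λ ^ 2 * Er) * CE ≤ ((1 + Λ ^ 2) * Er) * CE := mul_le_mul_of_nonneg_right h1a hCE
          _ = ((1 + Λ ^ 2) * CE) * Er := by ring
      have h2 : ((1 + Λ ^ 2) * CE) * Er ≤ (CAH + (1 + Λ ^ 2) * CE) * Er :=
        mul_le_mul_of_nonneg_right (by linarith only [hCAH]) (by positivity)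
      calc (1 + Λ ^ 2 * Er) * CE ≤ (CAH + (1 + Λ ^ 2) * CE) * Er * 1 := by rw [mul_one]; exact h1.trans h2
        _ ≤ (CAH + (1 + Λ ^ 2) * CE) * Er * (Λ ^ 2 * t ^ α) := mul_le_mul_of_nonneg_left hone (by positivity)
    exact fin hkey (min_le_right _ _) hA1

end Cube

end Literature.MathematicalPhysics.QuantumFieldTheory.Balaban1983to89.B6HolderGrad2GEPairInputsV1

end
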